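import Summits.ResolutionOfSingularities.ResolutionOfSingularities.Theorems.HilbertSamuelEliminationSigmaMaxModificationsCorridor3WLadderIsoTailsSeparableTensorReduced
import Summits.ResolutionOfSingularities.ResolutionOfSingularities.Theorems.HilbertSamuelEliminationCampaignW42NearChain
import Mathlib.AlgebraicGeometry.Geometrically.Reduced
import Mathlib.AlgebraicGeometry.PullbackCarrier
import Mathlib.AlgebraicGeometry.Morphisms.Flat
import Mathlib.AlgebraicGeometry.Morphisms.Separated
import Mathlib.AlgebraicGeometry.Morphisms.FiniteType
import HarnessLib

/-!
# [OURS · L1 W4.2] K2-sep ROUTE A, brick (δ2, first part): **the scheme `X ×_k K` of a separable ground-field base change — reduced,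
# separated of finite type over `K` (characteristic `p`), and `pr₁ : X ×_k K → X` surjective**
# (Mathlib: `Spec K → Spec k` is flat and — by (α) `isReduced_tensorProduct_of_isSeparable` — GEOMETRICALLY REDUCED, so the base change of a
# reduced locally noetherian scheme is reduced; base-change instances for the structure morphism; `Scheme.Pullback.range_fst`)
# (crux `SigmaMaxModifications` stmt-ResolutionOfSingularities-18506 / conjunct stmt-…-19249; line `w_ladder_rows` v8.5, registered stub
# `stub_isoSepRecurrent`; res-L1-w42-plan-1 WORD 2026-08-27T16:25:47Z; design `L/res-L1-w42-stub-2/k2sep/K2SEP-DESIGN.md` §8 (δ2)(a)(c)(e))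

Prover res-L1-w42-stub-2 (gen 5). Helper file `--supports stmt-ResolutionOfSingularities-19249 --as helper`; no definitions, no named fact. OURS
(cell res-hironaka, slot W4.2); NOT statements of [Hironaka2017] nor of [CossartJannsenSaito2020]. AI-written; AI review is weaker than expert
review. These are the inputs `hstr`, `hred`, `hsurj` of (β3) `isMaximalOrigin_of_hsFun_eq` / `isIsolatedInHSMaxLocus_of_hsFun_eq` for
`X′ = X ×_k K`; the remaining inputs (fibre over a closed point finite and closed, `dim X_K ≤ N`) are memo §8 (δ2)(b)(d).

* `geometricallyReduced_SpecMap_algebraMap_of_isSeparable` — `Spec K → Spec k` is geometrically reduced for `K/k` separable algebraic (any degree).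
* **`isReduced_pullback_SpecMap_of_isSeparable`** — `X` reduced locally noetherian ⟹ `X ×_k K` reduced.
* **`surjective_fst_pullback_SpecMap_field`** — `pr₁ : X ×_k K → X` is surjective.
* **`exists_structure_pullback_SpecMap`** — `X ×_k K → Spec K` is separated, locally of finite type and quasi-compact when `X → Spec k` is,
  with `CharP K p` — the `exists_structure` clause of `IsMaximalOrigin` for `X ×_k K`.

[OURS · L1 W4.2; AI-written] [cite: GrothendieckDieudonne1965, Prop. (4.6.1)] [cite: CossartJannsenSaito2020, Def. 2.35]
-/

set_option linter.dupNamespace false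

noncomputable section

open scoped TensorProduct
open CategoryTheory CategoryTheory.Limits AlgebraicGeometry
open Summit.ResolutionOfSingularities.ResolutionOfSingularities.Theorems.CampaignW42

namespace Summit.ResolutionOfSingularities.ResolutionOfSingularities.Theorems.SigmaMaxModificationsCorridor3.IsoTailsHS

universe u

variable (k K : Type u) [Field k] [Field K] [Algebra k K]

/-- **`Spec K → Spec k` is GEOMETRICALLY REDUCED for `K/k` separable algebraic of any degree** (every field base change
`Spec K ×_k Spec K′ ≅ Spec (K ⊗ₖ K′)` is reduced — (α) `isReduced_tensorProduct_of_isSeparable`; Mathlib `pullbackSpecIso`).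
[cite: GrothendieckDieudonne1965, Prop. (4.6.1)] -/
theorem geometricallyReduced_SpecMap_algebraMap_of_isSeparable [Algebra.IsSeparable k K] :
    GeometricallyReduced (Spec.map (CommRingCat.ofHom (algebraMap k K))) := by
  rw [geometricallyReduced_iff, geometrically_iff_of_commRing_of_isClosedUnderIsomorphisms]
  intro K' _ _
  haveI := isReduced_tensorProduct_of_isSeparable k K K'
  exact isReduced_of_isOpenImmersion (pullbackSpecIso k K K').hom

variable {k K}

/-- **`X ×_k K` is REDUCED** for `X` reduced locally noetherian over `k` and `K/k` separable algebraic (Mathlib: base change along a flat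
geometrically reduced morphism; flatness as in res-…'s `flat_specMap_algebraMap_field`). [cite: GrothendieckDieudonne1965, Prop. (4.6.1)] -/
theorem isReduced_pullback_SpecMap_of_isSeparable [Algebra.IsSeparable k K] {X : Scheme.{u}} (f : X ⟶ Spec (CommRingCat.of k))
    [IsReduced X] [IsLocallyNoetherian X] : IsReduced (pullback f (Spec.map (CommRingCat.ofHom (algebraMap k K)))) := by
  haveI := geometricallyReduced_SpecMap_algebraMap_of_isSeparable k K
  haveI : Flat (Spec.map (CommRingCat.ofHom (algebraMap k K))) := by
    rw [HasRingHomProperty.Spec_iff (P := @Flat), CommRingCat.hom_ofHom, RingHom.flat_algebraMap_iff]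
    infer_instance
  infer_instance

/-- **`pr₁ : X ×_k K → X` is surjective** (`Spec K → Spec k` is surjective: both are points; Mathlib `Scheme.Pullback.range_fst`).
[folklore] -/
theorem surjective_fst_pullback_SpecMap_field {X : Scheme.{u}} (f : X ⟶ Spec (CommRingCat.of k)) :
    Function.Surjective (pullback.fst f (Spec.map (CommRingCat.ofHom (algebraMap k K)))).base := by
  rw [← Set.range_eq_univ]
  have h := Scheme.Pullback.range_fst f (Spec.map (CommRingCat.ofHom (algebraMap k K)))
  change Set.range ⇑(ConcreteCategory.hom (pullback.fst f _).base) = _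
  rw [h, Set.eq_univ_iff_forall]
  intro x
  refine ⟨(default : ↥(Spec (CommRingCat.of K))), Subsingleton.elim _ _⟩

/-- **The structure clause of `IsMaximalOrigin` for `X ×_k K`**: if `X → Spec k` is separated, locally of finite type and quasi-compact and
`k` has characteristic `p`, then so is `X ×_k K → Spec K`, and `K` has characteristic `p`. [folklore] -/
theorem exists_structure_pullback_SpecMap {p : ℕ} [CharP k p] {X : Scheme.{u}} (f : X ⟶ Spec (CommRingCat.of k))
    [IsSeparated f] [LocallyOfFiniteType f] [QuasiCompact f] :
    ∃ (K' : Type u) (_ : Field K') (_ : CharP K' p) (g : pullback f (Spec.map (CommRingCat.ofHom (algebraMap k K))) ⟶ Spec (.of K')),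
      IsSeparated g ∧ LocallyOfFiniteType g ∧ QuasiCompact g := by
  haveI : CharP K p := charP_of_injective_algebraMap (algebraMap k K).injective p
  exact ⟨K, inferInstance, inferInstance, pullback.snd f _, inferInstance, inferInstance, inferInstance⟩

end Summit.ResolutionOfSingularities.ResolutionOfSingularities.Theorems.SigmaMaxModificationsCorridor3.IsoTailsHS

end
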